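import Summits.BirchSwinnertonDyer.BirchSwinnertonDyer.Theorems.AlignedTransportAtTwoBSDOfMainConjectureRankOneAtTwoEulerCharAtTwoKerGLemma34
import Summits.BirchSwinnertonDyer.BirchSwinnertonDyer.Theorems.AlignedTransportAtTwoBSDOfMainConjectureRankOneAtTwoEulerCharAtTwoCell
import HarnessLib

/-!
# Route `AlignedTransportAtTwo`, crux C3′ `BSDOfMainConjectureRankOneAtTwo` (stmt-BirchSwinnertonDyer-23008), line `birth` — ON THE C3′ CELL the
# open stub is ONE EQUATION: `#ker θ · log₂ 5 = u · #coker θ · Reg₂(Dh) · i_S` (the finiteness conjuncts of (H′) are automatic; rank pinned to `1`),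
# modulo modularity + Gross–Zagier–Kolyvagin only

HONEST FRAMING (cell `bsd-f1-sign2`, WIDTH-5 attach seat `bsd-line-att-p3` g13 under the C3′ lead lineage `bsd-line-att-p1`;
`--supports stmt-BirchSwinnertonDyer-23008 --as helper`). BSD is NOT proved; C3′ is NOT closed; nothing is asserted. THEOREMS ONLY (no `def`, no
named fact, no `sorry`). Capstone of the att-p3 lineage's (L)/(H) road (`…KerGIndex`, `…KerGShaExponent`, `…KerGCell`, `…KerGLocalOrders`,
`…KerGLemma34`).

WHAT IS PROVED. Let `W` carry the binders of the crux that the road uses — `IsOrdinaryAt W 2`, `E(ℚ)[2] = 0`, `W.analyticRank = 1`, the simple zero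
of `L₂(f_E, T)` at `T = 0` (`hL`) and `MazurMainConjecture W 2` (`hMC`) — and grant the two PRINT facts modularity (`hmod`) and GZK (`hGZK`).
* §1 `finite_ker_and_coker_derivedKummerMap_of_cell` — for every cyclotomic datum, every finitely generated strict dual `D`, and every choice
  `e`, `e₀`, `κ_M : M ↪ Sel_{2^∞}(E/ℚ)` (cokernel of order `#Ш(2)`), the derived Kummer map `θ` HAS FINITE KERNEL AND FINITE COKERNEL: att-p4 g6's
  `…EulerCharAtTwoCell.finite_bockstein_of_cell` (`X` torsion with `ord_T f_E = 1 = rank`, hence `ker φ_X` finite — `Λ`-algebra + Mazur control, no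
  height) fed to att-p4 g7's `…AssemblyKummer.finite_and_natCard_derivedKummerMap`.
* §2 **`schneiderLeadingTermFormulaAtTwoSqAt_iff_bareIdentity_of_cell`** — for such `W` and every finite `S ⊇ {2} ∪ {bad}`:
  `SchneiderLeadingTermFormulaAtTwoSqAt W` ⟺ (H″) «for every cyclotomic datum, every finitely generated torsion strict dual `D`, THE `Σ²` height `Dh`
  with `Reg₂(Dh) ≠ 0`, `Ш(E/ℚ)(2)` finite, every `e`, `e₀`, `κ_M`, and `θ` the derived Kummer map: **`∃ u ∈ ℤ₂ˣ, #ker θ · log₂ 5 = u · #coker θ ·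
  Reg₂(Dh) · i_S`**», `i_S = (∏_{v∈S} #𝒦_{v,0}[2^∞]) / #(A₀/Sel₀)` — ONE EQUATION per datum (att-p3 g13's `…KerGLemma34.…_iff_heightIndexRatioAt` with
  its finiteness conjuncts discharged by §1 and `(log₂5)^{rank}` pinned to `log₂ 5` by GZK). No named fact beyond `hmod`, `hGZK`.

READING (for the lead / the planner; the census line of C3′): per cell curve, modulo {modularity, GZK} (and Disegni + Σ² for the passage to `BSDp`),
the crux is the `2`-adic VALUATION identity `v₂(#ker θ) − v₂(#coker θ) = v₂(Reg₂(Dh)) + v₂(i_S) − 2` (`v₂(log₂ 5) = 2`) for the derived Kummer map of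
`E(ℚ) ⊗ ℚ₂/ℤ₂ → H¹(Γ, Sel_{2^∞}(E/ℚ_∞))` — Schneider 1985 §§6–8 / Perrin-Riou 1992 §3.4 prove the odd-`p` analogue («the Bockstein pairing is the
canonical height»); nothing in print at `2` over `ℚ`; the tree has no object for the algebraic (Iwasawa-theoretic) height. Closes nothing.

References: [GreenbergLNM1716] §3 Lemmas 3.3–3.4, §4 Lemmas 4.2–4.7; [PerrinRiou1992] §3.4; [Schneider1985] §§6–8; [CoatesSchneiderSujatha2003] p. 204;
[GrossZagier1986]; [Kolyvagin1990]; [BreuilConradDiamondTaylor2001].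
bears_on: stmt-BirchSwinnertonDyer-23008 (helper; closes nothing), stmt-BirchSwinnertonDyer-22298 (attach seat's item; untouched).
-/

set_option autoImplicit false
-- the Theorems namespace of this sub repeats the summit name by design (D-0017 nested layout)
set_option linter.dupNamespace false

noncomputable section

open scoped Classical NumberField MatrixGroups ModularForm

open Field NumberField IsDedekindDomain Function WeierstrassCurve CongruenceSubgroup
open Literature.NumberTheory.EllipticCurves Literature.NumberTheory.EllipticCurves.GreenbergSelmer
  Literature.NumberTheory.EllipticCurves.ModularForms
open Literature.NumberTheory.GaloisRepresentations
open Literature.NumberTheory.GaloisCohomology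
open scoped ContRepresentation

namespace Summit.BirchSwinnertonDyer.BirchSwinnertonDyer.Theorems.AlignedTransportAtTwoEulerCharAtTwoKerGCellBare

open Summit.BirchSwinnertonDyer.BirchSwinnertonDyer.Theorems.AlignedTransportAtTwoEulerCharAtTwoKerGCell
open Summit.BirchSwinnertonDyer.BirchSwinnertonDyer.Theorems.AlignedTransportAtTwoEulerCharAtTwoKerGLemma34
open ZpExtension Literature.NumberTheory.EllipticCurves.IwasawaAlgebra Literature.NumberTheory.EllipticCurves.IwasawaDual
open Literature.NumberTheory.EllipticCurves.Greenberg1999 Rat.HeightOneSpectrum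
open Summit.BirchSwinnertonDyer.BirchSwinnertonDyer.Theorems.Rank1ResidualX1Defs

variable (W : WeierstrassCurve ℚ) [W.IsElliptic] [W.IsGloballyMinimal]

/-! ## §1 On the cell the derived Kummer map has finite kernel and finite cokernel -/

/-- **ON THE C3′ CELL `θ` HAS FINITE KERNEL AND FINITE COKERNEL** (modulo modularity `hmod` and GZK `hGZK`): for `W/ℚ` globally minimal with
`IsOrdinaryAt W 2`, `E(ℚ)[2] = 0`, `r_an = 1`, the simple zero `ord_T L₂(f_E) = 1` and `MazurMainConjecture W 2`, every cyclotomic datum `(κ, γ)`, every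
finitely generated strict dual `D`, `Ш(E/ℚ)(2)` finite (a carried binder; GZK gives it), and every `e`, `e₀`, `κ_M : M ↪ Sel_{2^∞}(E/ℚ)` with cokernel of
order `#Ш(2)`: the derived Kummer map `θ = φ_{Sel} ∘ e ∘ s₀ ∘ e₀ ∘ κ_M` has `Finite θ.ker ∧ Finite coker θ`. Ingredients: `…EulerCharAtTwoCell.finite_bockstein_of_cell`
(`X` torsion, `ker φ_X` finite) and `…AssemblyKummer.finite_and_natCard_derivedKummerMap`.
[cite: GreenbergLNM1716, §4 Lemmas 4.2–4.7] [cite: CoatesSchneiderSujatha2003, §3 (30)–(31), p. 204] -/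
theorem finite_ker_and_coker_derivedKummerMap_of_cell (hGZK : rank_eq_analyticRank_of_analyticRank_le_one)
    (hmod : nonempty_modularParametrizationData) (hord : IsOrdinaryAt W 2) (hK : ∀ P : W.toAffine.Point, 2 • P = 0 → P = 0)
    (hr : W.analyticRank = 1)
    (hL : ∀ [NeZero (W.conductorNorm ℤ)] (f : CuspForm (Gamma0 (W.conductorNorm ℤ)) 2), IsNewformOf W f →
      (padicLFunction f (unitRoot W 2 : ℚ_[2])).order = 1)
    (hMC : MazurMainConjecture W 2) {κ : ZpExtension ℚ 2} {γ : Field.absoluteGaloisGroup ℚ}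
    (hκ : κ.IsCyclotomic) (hγ : κ.IsTopGenerator γ) (hγ' : IsCyclotomicVariable 2 γ)
    (D : W.SelmerDualData κ γ) [Module.Finite (IwasawaAlgebra 2) D.X] (hSha : Finite (AddCommGroup.primaryComponent W.sha 2))
    (e : ↥(W.selmerInfty κ ⊓ W.layerInvariants κ 0) ≃+ ↥(endInvariants (W.conjSelmerInfty κ γ - 1)))
    (e₀ : ↥(W.selmerGroupPInfty 2) ≃+ ↥(W.selmerLayer κ 0))
    {M : Type} [AddCommGroup M] (kS : M →+ ↥(W.selmerGroupPInfty 2)) (hkS : Function.Injective kS)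
    (hkS' : Nat.card (↥(W.selmerGroupPInfty 2) ⧸ kS.range) = Nat.card (AddCommGroup.primaryComponent W.sha 2))
    (θ : M →+ EndCoinvariants (W.conjSelmerInfty κ γ - 1))
    (hθ : θ = (W.selmerInftyEulerMap κ γ).comp
      (((e : ↥(W.selmerInfty κ ⊓ W.layerInvariants κ 0) →+ ↥(endInvariants (W.conjSelmerInfty κ γ - 1))).comp (W.sMap κ 0)).comp
        ((e₀ : ↥(W.selmerGroupPInfty 2) →+ ↥(W.selmerLayer κ 0)).comp kS))) :
    Finite θ.ker ∧ Finite (EndCoinvariants (W.conjSelmerInfty κ γ - 1) ⧸ θ.range) := by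
  obtain ⟨hX, -, hfin, -⟩ :=
    AlignedTransportAtTwoEulerCharAtTwoCell.finite_bockstein_of_cell hGZK hmod W hord hr hL hMC hκ hγ hγ' D
  haveI := W.finite_fixedPoints_kerSubgroup_geomPrimaryTorsion κ (fun P hP ↦ hK P (by convert hP))
  haveI := AlignedTransportAtTwoEulerCharAtTwoAssemblyKummer.finite_kerG_zero_of_isOrdinaryAt W hord κ hκ
  obtain ⟨hk, hc, -⟩ := AlignedTransportAtTwoEulerCharAtTwoAssemblyKummer.finite_and_natCard_derivedKummerMap W κ hγ D hX hfin e e₀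
    kS hkS hkS' hSha θ hθ
  exact ⟨hk, hc⟩

/-! ## §2 On the cell the open stub ⟺ ONE equation per datum -/

set_option maxHeartbeats 2000000 in -- instance-path unifications on the local cohomology groups (as in `…KerGCell`)
/-- **ON THE C3′ CELL THE OPEN STUB IS ONE EQUATION (H″)** — modulo modularity (`hmod`) and GZK (`hGZK`) only. For `W/ℚ` globally minimal with
`IsOrdinaryAt W 2`, `E(ℚ)[2] = 0`, `r_an = 1`, `ord_T L₂(f_E) = 1` (`hL`), `MazurMainConjecture W 2` (`hMC`) and any finite `S ⊇ {2} ∪ {bad}`: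
`SchneiderLeadingTermFormulaAtTwoSqAt W` HOLDS IFF for every cyclotomic datum, every finitely generated torsion strict dual `D`, THE `Σ²` height `Dh`
with `Reg₂(Dh) ≠ 0`, `Ш(E/ℚ)(2)` finite, every `e`, `e₀`, `κ_M : M ↪ Sel_{2^∞}(E/ℚ)` (cokernel of order `#Ш(2)`) and `θ` the derived Kummer map,
**`∃ u ∈ ℤ₂ˣ, #ker θ · log₂ 5 = u · #coker θ · Reg₂(Dh) · i_S`**, `i_S = (∏_{v∈S} #𝒦_{v,0}[2^∞]) / #(A₀/Sel₀)` (the Cassels–Poitou–Tate index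
`[E(ℚ):E_𝒦]`, `…KerGCell.exists_level_kerIndexL_rat`; `log₂ 5 = log₂ γ_cyc`, `v₂ = 2`). This is `…KerGLemma34.schneiderLeadingTermFormulaAtTwoSqAt_iff_heightIndexRatioAt`
(no named fact) with its conjuncts `Finite ker θ ∧ Finite coker θ` DISCHARGED by §1 and `rank E(ℚ) = 1` (GZK). READING: the crux C3′ at a cell curve is
the valuation identity `v₂#ker θ − v₂#coker θ = v₂ Reg₂(Dh) + v₂ i_S − 2` — Schneider's height comparison at `2`; nothing else. Closes nothing.
[cite: GreenbergLNM1716, §3 Lemmas 3.3–3.4, §4 Lemmas 4.2–4.7] [cite: PerrinRiou1992, §3.4] [cite: Schneider1985, §§6–8] -/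
theorem schneiderLeadingTermFormulaAtTwoSqAt_iff_bareIdentity_of_cell (hGZK : rank_eq_analyticRank_of_analyticRank_le_one)
    (hmod : nonempty_modularParametrizationData) (hord : IsOrdinaryAt W 2) (hK : ∀ P : W.toAffine.Point, 2 • P = 0 → P = 0)
    (hr : W.analyticRank = 1)
    (hL : ∀ [NeZero (W.conductorNorm ℤ)] (f : CuspForm (Gamma0 (W.conductorNorm ℤ)) 2), IsNewformOf W f →
      (padicLFunction f (unitRoot W 2 : ℚ_[2])).order = 1)
    (hMC : MazurMainConjecture W 2)
    (S : Finset (HeightOneSpectrum (𝓞 ℚ))) (hS : ∀ v ∉ S, ((2 : ℕ) : 𝓞 ℚ) ∉ v.asIdeal ∧ W.HasGoodReductionAt v) :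
    Summit.BirchSwinnertonDyer.Rank1Residual.F1Sign2.SchneiderLeadingTermFormulaAtTwoSqAt W ↔
    (∀ (κ : ZpExtension ℚ 2) (γ : Field.absoluteGaloisGroup ℚ),
        κ.IsCyclotomic → κ.IsTopGenerator γ → IsCyclotomicVariable 2 γ →
      ∀ (D : W.SelmerDualData κ γ) [Module.Finite (IwasawaAlgebra 2) D.X], D.IsTorsion →
      ∀ (Dh : PAdicHeightData W 2), Dh.IsCanonicalSq →
        SchneiderConjecture Dh → Finite (AddCommGroup.primaryComponent W.sha 2) →
      ∀ (e : ↥(W.selmerInfty κ ⊓ W.layerInvariants κ 0) ≃+ ↥(endInvariants (W.conjSelmerInfty κ γ - 1)))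
        (e₀ : ↥(W.selmerGroupPInfty 2) ≃+ ↥(W.selmerLayer κ 0))
        (M : Type) [AddCommGroup M] (kS : M →+ ↥(W.selmerGroupPInfty 2)), Function.Injective kS →
        Nat.card (↥(W.selmerGroupPInfty 2) ⧸ kS.range) = Nat.card (AddCommGroup.primaryComponent W.sha 2) →
      ∀ (θ : M →+ EndCoinvariants (W.conjSelmerInfty κ γ - 1)),
        θ = (W.selmerInftyEulerMap κ γ).comp
          (((e : ↥(W.selmerInfty κ ⊓ W.layerInvariants κ 0) →+ ↥(endInvariants (W.conjSelmerInfty κ γ - 1))).comp (W.sMap κ 0)).comp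
            ((e₀ : ↥(W.selmerGroupPInfty 2) →+ ↥(W.selmerLayer κ 0)).comp kS)) →
        ∃ u : ℤ_[2]ˣ,
          (Nat.card θ.ker : ℚ_[2]) * padicLog 2 (cyclotomicGenerator 2) =
            ((u : ℤ_[2]) : ℚ_[2]) * Nat.card (EndCoinvariants (W.conjSelmerInfty κ γ - 1) ⧸ θ.range) * padicRegulator Dh *
              (((∏ v ∈ S, Nat.card (W.localTowerKerPrimary κ (v.adicCompletion ℚ) 0)) / Nat.card (W.KerG κ 0) : ℕ) : ℚ_[2])) := by
  have hrank1 : W.mordellWeilRank = 1 := by rw [(hGZK W (le_of_eq hr)).1, hr]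
  refine (schneiderLeadingTermFormulaAtTwoSqAt_iff_heightIndexRatioAt W hK hord S hS).trans ⟨?_, ?_⟩
  · intro h κ γ hκ hγ hγ' D _ hX Dh hDh hS' hSha e e₀ M _ kS hkS hkS' θ hθ
    obtain ⟨-, -, u, hu⟩ := h κ γ hκ hγ hγ' D hX Dh hDh hS' hSha e e₀ M kS hkS hkS' θ hθ
    refine ⟨u, ?_⟩
    rw [hrank1, pow_one] at hu
    exact hu
  · intro h κ γ hκ hγ hγ' D _ hX Dh hDh hS' hSha e e₀ M _ kS hkS hkS' θ hθ
    obtain ⟨u, hu⟩ := h κ γ hκ hγ hγ' D hX Dh hDh hS' hSha e e₀ M kS hkS hkS' θ hθ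
    obtain ⟨hk, hc⟩ := finite_ker_and_coker_derivedKummerMap_of_cell W hGZK hmod hord hK hr hL hMC hκ hγ hγ' D hSha e e₀ kS hkS
      hkS' θ hθ
    refine ⟨hk, hc, u, ?_⟩
    rw [hrank1, pow_one]
    exact hu

end Summit.BirchSwinnertonDyer.BirchSwinnertonDyer.Theorems.AlignedTransportAtTwoEulerCharAtTwoKerGCellBare

end
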